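import Literature.AnabelianGeometry.SemiGraphs.ProSigmaCuspInertiaFreeCyclic
import Literature.AnabelianGeometry.AbsoluteAnabelian.AbsTopII.DPSCIndexDataOfEmbeddingCuspCyclic
import Literature.AnabelianGeometry.AbsoluteAnabelian.AbsTopII.Prop13SmoothCurveModel
import HarnessLib

/-!
# [AbsTopII] Prop 1.3 (i) AS TYPED (F-0297) with NO hypothesis at smooth-curve-shape DPSC data, every `Σ`;
# the smooth-curve product model satisfies ALL of the typed Prop 1.3 (i)–(vii), (ix) simultaneously

S. Mochizuki, *Topics in Absolute Anabelian Geometry II* [AbsTopII] (bib `MochizukiAbsTopII2013`), §1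
Prop 1.3 (i) p. 11: «If `e` is a cusp of `𝔾`, then as abstract profinite groups, `I_e ≅ Ẑ^Σ`»; [CombGC]
Rmk 1.1.3 p. 7.  abc-iut-f-069's bridge `AbsTopII.DPSCIndexData.prop_1_3_i_ofEmbedding` proves the typed
(i) (`Prop_1_3_i`, F-0297) at every embedded / constructed DPSC-index datum from the ONE input «the cuspidal
subgroups of the PSC datum are free pro-`Σ`-cyclic»; `SemiGraphs/ProSigmaCuspInertiaFreeCyclic.lean`
(abc-iut-f-066) supplies that input at PSC data of SMOOTH-CURVE SHAPE for EVERY `Σ`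
(`PSCDatum.isFreeProSigmaCyclic_cuspGp_of_smoothCurve`).  This PROOF-ONLY file composes the two:

* `prop_1_3_i_ofEmbedding_of_smoothCurve` / `prop_1_3_i_ofOuterAction_of_smoothCurve` — F-0297 AS TYPED,
  hypothesis-free, at `DPSCIndexData.ofEmbedding` / `DPSCIndexData.ofOuterAction` of a smooth-curve-shape
  PSC datum (one vertex `Π_v = Π`, no nodes, `r ≥ 1` cusps `Π_{c_j} = closure ι₀⟨c_j⟩`), any profinite
  extension / any continuous outer action;
* `prop_1_3_i_of_toDPSCData_eq_ofEmbedding` — the same for ANY `X : DPSCIndexData` presented as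
  `X.toDPSCData = DPSCData.ofEmbedding …`, `X.Sigma = G.Sigma` (the shape of abc-iut-f-066's product model);
* `exists_smoothCurve_model_prop13_all` — consequently ONE datum WITH CUSPS (the smooth-curve product model
  `Π_H = Π_𝔾 × Ẑ^Σ` of `Prop13SmoothCurveModel.lean`) satisfies the typed `Prop_1_3_i ∧ Prop_1_3_ii ∧
  Prop_1_3_iii′ ∧ Prop13iii ∧ Prop13iv′ ∧ Prop13v ∧ Prop_1_3_v′ ∧ Prop13vi ∧ Prop13vii ∧ Prop13ix`
  simultaneously, for every nonempty set of primes `Σ` and every hyperbolic `(g, r)`, `r ≥ 1` — joint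
  satisfiability of FACT-LIST F-0275, F-0277, F-0278, F-0279, F-0280, F-0297, F-0298, F-0299, F-0300 as typed.

HONEST FRAMING: abstract-group model (Riemann existence / specialisation not in the tree); consistency
evidence for OUR typings, not an endorsement; typed ≠ proved; no side taken on [IUTchIII] Cor 3.12.
-/

noncomputable section

namespace Literature.AnabelianGeometry.AbsoluteAnabelian.AbsTopII.DPSCIndexData

open Literature.AnabelianGeometry.SemiGraphs
open Literature.AnabelianGeometry.SemiGraphs.SemiGraphOfAnabelioids (IsProSigmaCompletion)
open Literature.GroupTheory.CombinatorialGroupTheory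

universe u

section Embedding

variable {P : Type u} [Group P] [TopologicalSpace P] [IsTopologicalGroup P] [CompactSpace P] [T2Space P]
  [TotallyDisconnectedSpace P]
  (G : PSCDatum P) (E : ProfiniteGrp.{u}) (ι : P →* E) (hιc : Continuous ι) (hιi : Function.Injective ι)
  (hιr : IsClosed (ι.range : Set E)) (hιn : ι.range.Normal) (PiI : Subgroup E) (hIn : PiI.Normal)
  (hle : ι.range ≤ PiI) (σ : G.graph.N → ℕ) (hσ : ∀ e, Anabelioids.IsSigmaInteger G.Sigma (σ e))
  {g r : ℕ}

include hιc hιi in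
/-- **[AbsTopII] Prop 1.3 (i) AS TYPED (F-0297), hypothesis-free, at the embedded DPSC-index datum of a
smooth-curve-shape PSC datum**, every `Σ`: compose abc-iut-f-069's `prop_1_3_i_ofEmbedding` with
`PSCDatum.isFreeProSigmaCyclic_cuspGp_of_smoothCurve`. [cite: MochizukiAbsTopII2013, Prop 1.3 (i) p.11] -/
theorem prop_1_3_i_ofEmbedding_of_smoothCurve (h : PuncturedSurfaceGroup.IsHyperbolicType g r)
    (ι₀ : PuncturedSurfaceGroup g r →* P) (hι₀ : IsProSigmaCompletion G.Sigma ι₀) (e : G.graph.C ≃ Fin r)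
    (hC : ∀ c, G.cuspGp c =
      ((PuncturedSurfaceGroup.cuspInertia (g := g) (e c)).map ι₀).topologicalClosure) :
    (ofEmbedding G E ι hιr hιn PiI hIn hle σ hσ).Prop_1_3_i :=
  prop_1_3_i_ofEmbedding G E ι hιc hιi hιr hιn PiI hIn hle σ hσ
    (G.isFreeProSigmaCyclic_cuspGp_of_smoothCurve h ι₀ hι₀ e hC)

omit [IsTopologicalGroup P] [T2Space P] [TotallyDisconnectedSpace P] in
include hιc hιi in
/-- The same for any `Σ`-indexed DPSC datum PRESENTED by an embedding (`X.toDPSCData = DPSCData.ofEmbedding …`,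
`X.Sigma = Σ_G`; e.g. abc-iut-f-066's product model), from free pro-`Σ`-cyclic cuspidal subgroups.
[cite: MochizukiAbsTopII2013, Prop 1.3 (i) p.11] -/
theorem prop_1_3_i_of_toDPSCData_eq_ofEmbedding (X : DPSCIndexData.{u})
    (hX : X.toDPSCData = DPSCData.ofEmbedding G E ι hιr hιn PiI hIn hle) (hSig : X.Sigma = G.Sigma)
    (hcyc : ∀ c : G.graph.C, IsFreeProSigmaCyclic G.Sigma ↥(G.cuspGp c)) : X.Prop_1_3_i := by
  obtain ⟨X₀, S, hS, τ, hτ⟩ := X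
  cases hX
  cases hSig
  exact prop_1_3_i_ofEmbedding G E ι hιc hιi hιr hιn PiI hIn hle (fun n => τ ⟨n⟩) (fun n => hτ ⟨n⟩) hcyc

end Embedding

section OuterAction

variable {P : Type u} [Group P] [TopologicalSpace P] [IsTopologicalGroup P] [CompactSpace P] [T2Space P]
  [TotallyDisconnectedSpace P] (G : PSCDatum P) (hG : IsTopologicallyFinitelyGenerated P)
  (hZ : Subgroup.center P = ⊥)
  {J : Type u} [Group J] [TopologicalSpace J] [IsTopologicalGroup J] [CompactSpace J]
  [TotallyDisconnectedSpace J] (θ : J →ₜ* outProfinite hG) (I : Subgroup J) [I.Normal]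
  (σ : G.graph.N → ℕ) (hσ : ∀ e, Anabelioids.IsSigmaInteger G.Sigma (σ e)) {g r : ℕ}

include hZ in
/-- **[AbsTopII] Prop 1.3 (i) AS TYPED (F-0297), hypothesis-free, at the CONSTRUCTED extension
`Π_𝒢 ⋊^out_θ J` of a smooth-curve-shape PSC datum**, any continuous outer action `θ`, every `Σ`.
[cite: MochizukiAbsTopII2013, Prop 1.3 (i) p.11] -/
theorem prop_1_3_i_ofOuterAction_of_smoothCurve (h : PuncturedSurfaceGroup.IsHyperbolicType g r)
    (ι₀ : PuncturedSurfaceGroup g r →* P) (hι₀ : IsProSigmaCompletion G.Sigma ι₀) (e : G.graph.C ≃ Fin r)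
    (hC : ∀ c, G.cuspGp c =
      ((PuncturedSurfaceGroup.cuspInertia (g := g) (e c)).map ι₀).topologicalClosure) :
    (ofOuterAction G hG θ I σ hσ).Prop_1_3_i :=
  prop_1_3_i_ofOuterAction G hG hZ θ I σ hσ (G.isFreeProSigmaCyclic_cuspGp_of_smoothCurve h ι₀ hι₀ e hC)

end OuterAction

/-- **ALL of the typed [AbsTopII] Prop 1.3 (i), (ii), (iii), (iii′), (iv′), (v), (v′), (vi), (vii), (ix) hold
simultaneously at ONE datum WITH CUSPS** — abc-iut-f-066's smooth-curve product model `Π_H = Π_𝔾 × Ẑ^Σ`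
(`exists_smoothCurve_product_model`), now with (i) by `prop_1_3_i_of_toDPSCData_eq_ofEmbedding`: for every
nonempty set of primes `Σ` and every hyperbolic `(g, r)` with `r ≥ 1` there is a `Σ`-indexed DPSC datum with
`r` cusps, no nodes, `Σ`, at which F-0297, F-0298, F-0299, F-0300 (abc-iut-L4-t6) and F-0275, F-0277,
F-0278, F-0279, F-0280 (abc-iut-L4-t4) are jointly satisfied AS TYPED.  Abstract-group model; constructed ≠
geometric. [cite: MochizukiAbsTopII2013, Prop 1.3 pp.11-12] -/
theorem exists_smoothCurve_model_prop13_all (Sigma : Set ℕ) (hS₁ : Sigma.Nonempty)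
    (hS₂ : ∀ p ∈ Sigma, p.Prime) (g r : ℕ) (hgr : PuncturedSurfaceGroup.IsHyperbolicType g r)
    (hr : 0 < r) :
    ∃ X : DPSCIndexData.{0}, X.Sigma = Sigma ∧ Nonempty (X.Cusp ≃ Fin r) ∧ IsEmpty X.Node ∧
      X.Prop_1_3_i ∧ X.Prop_1_3_ii ∧ X.Prop_1_3_iii' ∧ X.toDPSCData.Prop13iii ∧ X.toDPSCData.Prop13iv' ∧
      X.toDPSCData.Prop13v ∧ X.Prop_1_3_v' ∧ X.toDPSCData.Prop13vi ∧ X.toDPSCData.Prop13vii ∧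
      X.toDPSCData.Prop13ix := by
  obtain ⟨Q, ι₀, hι₀, Z, _, G, hιr, hιn, X, -, -, hGS, _, -, -, -, ⟨e, hC⟩, -, -, -, -, hX, hXS, -, hCusp,
    hNode, -, -, -, -, -, -, -, -, -, -, -, -, -, -, -, -, -, -, -, -, -, -, -, -, hii, hiii', hiii, hiv',
    hv, hv', hvi, hvii, hix⟩ :=
    exists_smoothCurve_product_model Sigma hS₁ hS₂ g r hgr hr
  have hι₀' : IsProSigmaCompletion G.Sigma ι₀ := hGS ▸ hι₀
  refine ⟨X, hXS, hCusp, hNode, ?_, hii, hiii', hiii, hiv', hv, hv', hvi, hvii, hix⟩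
  exact prop_1_3_i_of_toDPSCData_eq_ofEmbedding G (ProfiniteGrp.of (Q × Z)) (MonoidHom.inl Q Z)
    (continuous_id.prodMk continuous_const) (fun a b hab => (Prod.ext_iff.mp hab).1) hιr hιn ⊤
    inferInstance le_top X hX (hXS.trans hGS.symm)
    (G.isFreeProSigmaCyclic_cuspGp_of_smoothCurve hgr ι₀ hι₀' e hC)

end Literature.AnabelianGeometry.AbsoluteAnabelian.AbsTopII.DPSCIndexData

end
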